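import Summits.MatrixMultiplication.OmegaCensus.DominoZpZpConsistCheck
import Summits.MatrixMultiplication.OmegaCensus.DominoZpZpMoments
import Summits.MatrixMultiplication.OmegaCensus.DominoLineUnitObstruction
import Mathlib.LinearAlgebra.Lagrange
import HarnessLib

/-!
# The moment-consistency checker: algebra (why the true shadows obey the checker's prediction rule)

ω-census `pub-omega`, family (b3), seat pub-omega-group gen 27.  Framing: lottery ticket; floor = certified bounds/negative
ranges.  VALUE: the algebraic half of G5 of the SHADOW-CONSISTENCY route (`DominoZpZpConsistCheck.lean` holds the programs);
NOT progress on ω.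

For a finite family of points `u a ∈ ZMod p × ZMod p` (`a ∈ X`) the `m`-th power moment of the shadow in direction
`u ↦ c·u.1 + u.2` is `μ_{0,m} + Q_m(c) + c^m μ_{m,0}` with `Q_m(t) = Σ_{0<i<m} C(m,i) μ_{i,m−i} t^i` (`DominoZpZpMoments.shadow_moment_eq`),
a polynomial of degree `< m` vanishing at `0`; by Lagrange interpolation through the nodes `0, 1, …, m−1` (Mathlib
`Lagrange.eq_interpolate`) its value at any `c` is `Σ_{0<i<m} Q_m(i) Π_{j≠i} (c−j)/(i−j)`, which is what `predDigit` computes in `ℕ`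
(`lagNum`, `lagInv` verified by `invCheck`).  Here: the cast lemmas (`momN_cast`, `lagNum_cast`, `predDigit_cast`, …), the Lagrange
step (`lagrange_eval_eq`, `momPoly_*`), the moment split (`momN_shadowL_cast`, `moment_split`), and the DIRECTION PACKAGE
`shadowL_mem`: for a shifted form and a surjection `Ψ : A ↠ ℤ_p²`, the shadow of `X` in any direction together with its shift is a
solution of the normalised line identity with constant `K = |A|/p`, hence LISTED whenever the instance's completeness hypothesis holds.
-/

namespace Summit.MatrixMultiplication.OmegaCensus

open Finset Polynomial

namespace ZpZpDomino

/-! ## Casts of the checker's `ℕ` arithmetic into `ZMod p` -/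

section Arith

variable {p : ℕ} [Fact p.Prime]

/-- A list sum over `List.range` is the `Finset.range` sum. [folklore] -/
private theorem list_sum_map_range {M : Type*} [AddCommMonoid M] (f : ℕ → M) (n : ℕ) :
    ((List.range n).map f).sum = ∑ i ∈ Finset.range n, f i := by
  induction n with
  | zero => simp
  | succ n ih => rw [List.range_succ, List.map_append, List.sum_append, ih, Finset.sum_range_succ]; simp

/-- Two naturals below `p` with equal casts are equal. [folklore] -/
private theorem nat_eq_of_cast_eq {a b : ℕ} (ha : a < p) (hb : b < p) (h : (a : ZMod p) = b) : a = b := by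
  have := (ZMod.natCast_eq_natCast_iff' a b p).1 h
  rwa [Nat.mod_eq_of_lt ha, Nat.mod_eq_of_lt hb] at this

/-- Cast of `momN`: `Σ_v v^m F[v]` in `ZMod p`. [folklore] -/
theorem momN_cast (F : List ℕ) (m : ℕ) :
    ((momN p F m : ℕ) : ZMod p) = ∑ v : ZMod p, v ^ m * (F.getD v.val 0 : ZMod p) := by
  unfold momN
  rw [ZMod.natCast_mod, list_sum_map_range, Nat.cast_sum,
    ← sum_val_eq_sum_range (fun i => (((i ^ m * F.getD i 0 : ℕ)) : ZMod p))]
  refine Finset.sum_congr rfl fun v _ => ?_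
  push_cast
  rw [ZMod.natCast_zmod_val]

/-- Cast of `lagNum`: `Π_{j<m, j≠i} (c − j)` (`m ≤ p`). [folklore] -/
theorem lagNum_cast {m : ℕ} (hm : m ≤ p) (i c : ℕ) :
    ((lagNum p m i c : ℕ) : ZMod p) = ∏ j ∈ (Finset.range m).erase i, ((c : ZMod p) - (j : ZMod p)) := by
  unfold lagNum
  rw [ZMod.natCast_mod, Nat.cast_prod]
  refine Finset.prod_congr rfl fun j hj => ?_
  have hjm : j < m := Finset.mem_range.1 (Finset.mem_of_mem_erase hj)
  rw [Nat.cast_sub (by omega), Nat.cast_add, ZMod.natCast_self, add_zero]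

/-- From `invCheck`: `lagInv` is the inverse of `lagNum p m i i` in `ZMod p` (`1 ≤ i < m ≤ M`). [folklore] -/
theorem lagInv_mul_of_invCheck {M : ℕ} (h : invCheck p M = true) {m i : ℕ} (hm : m ≤ M) (hi : 1 ≤ i) (him : i < m) :
    ((lagNum p m i i : ℕ) : ZMod p) * ((lagInv p m i : ℕ) : ZMod p) = 1 := by
  unfold invCheck at h
  simp only [List.all_eq_true, List.mem_range, Bool.or_eq_true, beq_iff_eq] at h
  rcases h m (by omega) i him with h | h
  · omega
  · have e := (ZMod.natCast_eq_natCast_iff' (lagNum p m i i * lagInv p m i) 1 p).2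
      (by rw [h, Nat.mod_eq_of_lt (Fact.out : p.Prime).one_lt])
    push_cast at e
    exact e

omit [Fact p.Prime] in
/-- Entries of `lagTab`. [folklore] -/
theorem getD_lagTab {M m i c : ℕ} (hm : m ≤ M) (hi : i < m) (hc : c < p) :
    (((lagTab p M).getD m []).getD i []).getD c 0 = lagInv p m i * lagNum p m i c % p := by
  unfold lagTab
  rw [getD_map_range _ (by omega), getD_map_range _ hi, getD_map_range _ hc]

/-- Cast of an entry of `pivotR`: `x_{i'} − ((i'+1)^m·am + bm)`. [folklore] -/
theorem pivotR_cast {m am bm : ℕ} {xs : List ℕ} {i' : ℕ} (hi : i' < m - 1) :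
    (((pivotR p m am bm xs).getD i' 0 : ℕ) : ZMod p) =
      (xs.getD i' 0 : ZMod p) - (((i' + 1 : ℕ) : ZMod p) ^ m * am + bm) := by
  have hp : 0 < p := (Fact.out : p.Prime).pos
  unfold pivotR
  rw [getD_map_range _ hi, ZMod.natCast_mod]
  have hlt : ((i' + 1) ^ m * am + bm) % p < p := Nat.mod_lt _ hp
  rw [Nat.cast_sub (by omega), Nat.cast_add, ZMod.natCast_self, add_zero, ZMod.natCast_mod]
  push_cast
  ring

/-- Cast of `predDigit` with the table `lagTab p M` (`2 ≤ m ≤ M < p`, `c < p`):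
`c^m·am + bm + Σ_{i'<m−1} R[i'] · (Π_{j≠i'+1}(i'+1−j))⁻¹ · Π_{j≠i'+1}(c−j)`. [folklore] -/
theorem predDigit_cast {M : ℕ} (hinv : invCheck p M = true) (hMp : M < p) {m c am bm : ℕ} (hm2 : 2 ≤ m) (hm : m ≤ M)
    (hc : c < p) (R : List ℕ) :
    ((predDigit p (lagTab p M) m c am bm R : ℕ) : ZMod p) =
      (c : ZMod p) ^ m * am + bm + ∑ i' ∈ Finset.range (m - 1), (R.getD i' 0 : ZMod p) *
        ((∏ j ∈ (Finset.range m).erase (i' + 1), (((i' + 1 : ℕ) : ZMod p) - (j : ZMod p)))⁻¹ *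
          ∏ j ∈ (Finset.range m).erase (i' + 1), ((c : ZMod p) - (j : ZMod p))) := by
  unfold predDigit
  rw [ZMod.natCast_mod, list_sum_map_range, Nat.cast_add, Nat.cast_add, Nat.cast_mul, Nat.cast_pow, Nat.cast_sum]
  congr 1
  refine Finset.sum_congr rfl fun i' hi' => ?_
  have hi'm : i' + 1 < m := by have := Finset.mem_range.1 hi'; omega
  rw [getD_lagTab hm hi'm hc, Nat.cast_mul, ZMod.natCast_mod, Nat.cast_mul, lagNum_cast (by omega)]
  congr 1
  congr 1
  have hunit := lagInv_mul_of_invCheck hinv hm (by omega) hi'm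
  rw [lagNum_cast (by omega)] at hunit
  exact eq_inv_of_mul_eq_one_right hunit

end Arith

/-! ## Lagrange interpolation through the nodes `0, …, m − 1` -/

section Lagrange

variable {p : ℕ} [Fact p.Prime]

/-- **Lagrange**: a polynomial of degree `< m ≤ p` over `ZMod p` is determined by its values at `0, …, m−1`:
`Q(c) = Σ_{i<m} Q(i) Π_{j<m, j≠i} (i−j)⁻¹ (c−j)`. [folklore] -/
theorem lagrange_eval_eq {m : ℕ} (hm : m ≤ p) (Q : (ZMod p)[X]) (hQ : Q.degree < m) (c : ZMod p) :
    Q.eval c = ∑ i ∈ Finset.range m, Q.eval (i : ZMod p) *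
      ∏ j ∈ (Finset.range m).erase i, ((((i : ℕ) : ZMod p) - (j : ZMod p))⁻¹ * (c - (j : ZMod p))) := by
  have hinj : Set.InjOn (fun i : ℕ => (i : ZMod p)) ↑(Finset.range m) := by
    intro a ha b hb hab
    have ha' : a < p := lt_of_lt_of_le (Finset.mem_range.1 (Finset.mem_coe.1 ha)) hm
    have hb' : b < p := lt_of_lt_of_le (Finset.mem_range.1 (Finset.mem_coe.1 hb)) hm
    exact nat_eq_of_cast_eq ha' hb' hab
  have h := Lagrange.eq_interpolate (v := fun i : ℕ => (i : ZMod p)) (s := Finset.range m) hinj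
    (by rw [Finset.card_range]; exact hQ)
  conv_lhs => rw [h]
  rw [Lagrange.interpolate_apply, Polynomial.eval_finsetSum]
  refine Finset.sum_congr rfl fun i _ => ?_
  rw [Polynomial.eval_mul, Polynomial.eval_C]
  congr 1
  rw [Lagrange.basis, Polynomial.eval_prod]
  refine Finset.prod_congr rfl fun j _ => ?_
  rw [Lagrange.basisDivisor, Polynomial.eval_mul, Polynomial.eval_C, Polynomial.eval_sub, Polynomial.eval_X,
    Polynomial.eval_C]

/-- The moment polynomial `Q_m(t) = Σ_{0<i<m} C(m,i) μ_{i,m−i} t^i`. [folklore] -/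
noncomputable def momPoly (m : ℕ) (μ : ℕ → ℕ → ZMod p) : (ZMod p)[X] :=
  ∑ i ∈ (Finset.range m).erase 0, C ((m.choose i : ZMod p) * μ i (m - i)) * X ^ i

/-- `deg Q_m < m`. [folklore] -/
theorem momPoly_degree_lt (m : ℕ) (μ : ℕ → ℕ → ZMod p) : (momPoly m μ).degree < m := by
  rw [Polynomial.degree_lt_iff_coeff_zero]
  intro k hk
  rw [momPoly, Polynomial.finsetSum_coeff]
  refine Finset.sum_eq_zero fun i hi => ?_
  have him : i < m := Finset.mem_range.1 (Finset.mem_of_mem_erase hi)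
  rw [Polynomial.coeff_C_mul_X_pow, if_neg (by omega)]

/-- Values of `Q_m`. [folklore] -/
theorem momPoly_eval (m : ℕ) (μ : ℕ → ℕ → ZMod p) (t : ZMod p) :
    (momPoly m μ).eval t = ∑ i ∈ (Finset.range m).erase 0, (m.choose i : ZMod p) * μ i (m - i) * t ^ i := by
  rw [momPoly, Polynomial.eval_finsetSum]
  refine Finset.sum_congr rfl fun i _ => ?_
  rw [Polynomial.eval_mul, Polynomial.eval_C, Polynomial.eval_pow, Polynomial.eval_X]

/-- `Q_m(0) = 0`. [folklore] -/
theorem momPoly_eval_zero (m : ℕ) (μ : ℕ → ℕ → ZMod p) : (momPoly m μ).eval 0 = 0 := by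
  rw [momPoly_eval]
  refine Finset.sum_eq_zero fun i hi => ?_
  rw [zero_pow (Finset.ne_of_mem_erase hi), mul_zero]

/-- **The prediction rule for `Q_m`**, in the shape of `predDigit_cast`:
`Q(c) = Σ_{i'<m−1} Q(i'+1) · (Π_{j≠i'+1}(i'+1−j))⁻¹ · Π_{j≠i'+1}(c−j)` (`m ≤ p`). [folklore] -/
theorem momPoly_eval_eq_sum {m : ℕ} (hm : m ≤ p) (hm1 : 1 ≤ m) (μ : ℕ → ℕ → ZMod p) (c : ZMod p) :
    (momPoly m μ).eval c = ∑ i' ∈ Finset.range (m - 1), (momPoly m μ).eval ((i' + 1 : ℕ) : ZMod p) *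
      ((∏ j ∈ (Finset.range m).erase (i' + 1), (((i' + 1 : ℕ) : ZMod p) - (j : ZMod p)))⁻¹ *
        ∏ j ∈ (Finset.range m).erase (i' + 1), (c - (j : ZMod p))) := by
  rw [lagrange_eval_eq hm _ (momPoly_degree_lt m μ) c]
  obtain ⟨m', rfl⟩ : ∃ m', m = m' + 1 := ⟨m - 1, by omega⟩
  rw [Finset.sum_range_succ', Nat.cast_zero, momPoly_eval_zero, zero_mul, add_zero, Nat.add_sub_cancel]
  refine Finset.sum_congr rfl fun i' _ => ?_
  rw [Finset.prod_mul_distrib, Finset.prod_inv_distrib]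

end Lagrange

/-! ## Shadows of a point family and their moments -/

section Shadow

variable {p : ℕ} [Fact p.Prime] {A : Type*}

/-- The shadow of `X` under `u` in direction `(c₁, c₂)` as a list of counts: `[#{a : c₁(u a).1 + c₂(u a).2 = v}]_{v<p}`. [folklore] -/
def shadowL (u : A → ZMod p × ZMod p) (X : Finset A) (c₁ c₂ : ZMod p) : List ℕ :=
  (List.range p).map fun v => (X.filter fun a => lmap c₁ c₂ (u a) = ((v : ℕ) : ZMod p)).card

/-- Entries of `shadowL`. [folklore] -/
theorem getD_shadowL (u : A → ZMod p × ZMod p) (X : Finset A) (c₁ c₂ : ZMod p) (v : ZMod p) :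
    (shadowL u X c₁ c₂).getD v.val 0 = (X.filter fun a => lmap c₁ c₂ (u a) = v).card := by
  unfold shadowL
  rw [getD_map_range _ (ZMod.val_lt v), ZMod.natCast_zmod_val]

/-- Length of `shadowL`. [folklore] -/
theorem length_shadowL (u : A → ZMod p × ZMod p) (X : Finset A) (c₁ c₂ : ZMod p) : (shadowL u X c₁ c₂).length = p := by
  simp [shadowL]

/-- The entries of `shadowL` sum to `|X|`. [folklore] -/
theorem sum_shadowL (u : A → ZMod p × ZMod p) (X : Finset A) (c₁ c₂ : ZMod p) : (shadowL u X c₁ c₂).sum = X.card := by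
  unfold shadowL
  rw [list_sum_map_range, ← sum_val_eq_sum_range (fun i => (X.filter fun a => lmap c₁ c₂ (u a) = ((i : ℕ) : ZMod p)).card)]
  simp only [ZMod.natCast_zmod_val]
  rw [Finset.card_eq_sum_card_fiberwise (f := fun a => lmap c₁ c₂ (u a)) (s := X) (t := Finset.univ)
    (fun a _ => Finset.mem_coe.2 (Finset.mem_univ _))]

/-- **Moments of a shadow** (cast of `momN` of `shadowL`): `Σ_{i≤m} C(m,i) c₁^i c₂^{m−i} μ_{i,m−i}`. [folklore] -/
theorem momN_shadowL_cast (u : A → ZMod p × ZMod p) (X : Finset A) (c₁ c₂ : ZMod p) (m : ℕ) :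
    ((momN p (shadowL u X c₁ c₂) m : ℕ) : ZMod p) =
      ∑ i ∈ Finset.range (m + 1), (m.choose i : ZMod p) * c₁ ^ i * c₂ ^ (m - i) * mixedMoment u X i (m - i) := by
  rw [momN_cast, ← shadow_moment_eq u X c₁ c₂ m]
  refine Finset.sum_congr rfl fun v _ => ?_
  rw [getD_shadowL]

/-- Direction `(1, 0)`: the `m`-th moment is `μ_{m,0}`. [folklore] -/
theorem momN_shadowL_fst (u : A → ZMod p × ZMod p) (X : Finset A) (m : ℕ) :
    ((momN p (shadowL u X 1 0) m : ℕ) : ZMod p) = mixedMoment u X m 0 := by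
  rw [momN_shadowL_cast, Finset.sum_eq_single_of_mem m (Finset.mem_range.2 (Nat.lt_succ_self m))]
  · rw [Nat.choose_self, Nat.sub_self]; simp
  · intro i hi him
    have : m - i ≠ 0 := by have := Finset.mem_range.1 hi; omega
    rw [zero_pow this]; simp

/-- Direction `(0, 1)`: the `m`-th moment is `μ_{0,m}`. [folklore] -/
theorem momN_shadowL_snd (u : A → ZMod p × ZMod p) (X : Finset A) (m : ℕ) :
    ((momN p (shadowL u X 0 1) m : ℕ) : ZMod p) = mixedMoment u X 0 m := by
  rw [momN_shadowL_cast, Finset.sum_eq_single_of_mem 0 (Finset.mem_range.2 (Nat.succ_pos m))]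
  · simp
  · intro i _ hi0
    rw [zero_pow hi0]; simp

/-- **Moment split in direction `(c, 1)`**: `M_m(c) = μ_{0,m} + Q_m(c) + c^m μ_{m,0}` (`1 ≤ m`). [folklore] -/
theorem moment_split (u : A → ZMod p × ZMod p) (X : Finset A) (c : ZMod p) {m : ℕ} (hm : 1 ≤ m) :
    ((momN p (shadowL u X c 1) m : ℕ) : ZMod p) =
      mixedMoment u X 0 m + (momPoly m (mixedMoment u X)).eval c + c ^ m * mixedMoment u X m 0 := by
  rw [momN_shadowL_cast, Finset.sum_range_succ, Nat.choose_self, Nat.sub_self,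
    ← Finset.add_sum_erase _ _ (Finset.mem_range.2 (by omega : 0 < m)), momPoly_eval]
  simp only [one_pow, mul_one, pow_zero, Nat.choose_zero_right, Nat.cast_one, Nat.sub_zero, one_mul]
  congr 1; congr 1
  refine Finset.sum_congr rfl fun i _ => ?_
  ring

end Shadow

/-! ## The direction package: shadows of a shifted form are solutions of the line identity, hence listed -/

section Direction

variable {p : ℕ} [Fact p.Prime] {A : Type*} [AddCommGroup A] [DecidableEq A] [Fintype A]

/-- All fibres of a surjection `A ↠ ZMod p` have size `K = |A|/p`. [folklore] -/
theorem card_fibre_eq_of_card (φ : A →+ ZMod p) (hφ : Function.Surjective φ) {K : ℕ} (hA : Fintype.card A = p * K)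
    (t : ZMod p) : (univ.filter fun a : A => φ a = t).card = K := by
  have hp : 0 < p := (Fact.out : p.Prime).pos
  have h := Finset.card_eq_sum_card_fiberwise (f := fun a : A => φ a) (s := (univ : Finset A)) (t := (univ : Finset (ZMod p)))
    (fun a _ => Finset.mem_coe.2 (Finset.mem_univ _))
  rw [Finset.sum_congr rfl fun t' _ => card_fibre_eq_of_surjective φ hφ t' t, Finset.sum_const, smul_eq_mul,
    Finset.card_univ, Finset.card_univ, ZMod.card, hA] at h
  exact (Nat.eq_of_mul_eq_mul_left hp h).symm

/-- A line form `lmap c₁ c₂` with `c₂ ≠ 0` or `c₁ ≠ 0` is onto. [folklore] -/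
theorem lmap_surjective_of_ne {c₁ c₂ : ZMod p} (h : c₁ ≠ 0 ∨ c₂ ≠ 0) : Function.Surjective (lmap c₁ c₂) := by
  intro t
  rcases h with h | h
  · exact ⟨(c₁⁻¹ * t, 0), by simp [lmap_apply, ← mul_assoc, mul_inv_cancel₀ h]⟩
  · exact ⟨(0, c₂⁻¹ * t), by simp [lmap_apply, ← mul_assoc, mul_inv_cancel₀ h]⟩

/-- `lmap` commutes with the scalar `η`. [folklore] -/
theorem lmap_smul (c₁ c₂ η : ZMod p) (x : ZMod p × ZMod p) : lmap c₁ c₂ (η • x) = η * lmap c₁ c₂ x := by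
  simp only [lmap_apply, Prod.smul_fst, Prod.smul_snd, smul_eq_mul]
  ring

/-- **Direction package.**  For a shifted form, a surjection `Ψ : A ↠ ℤ_p²` and a nonzero direction `(c₁, c₂)`: the shadow of
`X` under `u a = Ψ a − η•Ψβ` in that direction, with shift `lmap c₁ c₂ (Ψ x₀ − η•Ψβ − η•Ψγ)`, solves the normalised line identity
with constant `K = |A|/p`; so it is LISTED under the completeness hypothesis `hcomp`. [folklore] -/
theorem shadowL_mem (η : ZMod p) (hη : η + η = 1) (Ψ : A →+ ZMod p × ZMod p) (hΨ : Function.Surjective Ψ)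
    {X Y : Finset A} {β γ x₀ : A} {d K : ℕ} (hXd : X.card = d) (hA : Fintype.card A = p * K)
    (Lst : List (List ℕ × ℕ))
    (hcomp : ∀ F ∈ compsLB [] p d, ∀ (G : ZMod p → ℕ) (s : ZMod p),
      (∀ τ : ZMod p, (∑ v : ZMod p, (vecFn F (τ - v) + vecFn F (v - τ) + vecFn F (τ + v)) * G v) +
        (if s = τ then 1 else 0) = K) → (F, s.val) ∈ Lst)
    (hinj : Set.InjOn (fun q : A × A => q.1 + q.2) ↑(X ×ˢ Y))
    (hPQ : Disjoint ((X ×ˢ Y).image fun q : A × A => q.1 + q.2)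
      (((Y ×ˢ X).image fun q : A × A => q.1 - q.2).image fun z => z + β))
    (hPR : Disjoint ((X ×ˢ Y).image fun q : A × A => q.1 + q.2)
      (((X ×ˢ Y).image fun q : A × A => q.1 - q.2).image fun z => z + γ))
    (hQR : Disjoint (((Y ×ˢ X).image fun q : A × A => q.1 - q.2).image fun z => z + β)
      (((X ×ˢ Y).image fun q : A × A => q.1 - q.2).image fun z => z + γ))
    (hcover : ((X ×ˢ Y).image fun q : A × A => q.1 + q.2) ∪
      (((Y ×ˢ X).image fun q : A × A => q.1 - q.2).image fun z => z + β) ∪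
      (((X ×ˢ Y).image fun q : A × A => q.1 - q.2).image fun z => z + γ) = univ.erase x₀)
    (c₁ c₂ : ZMod p) (hc : c₁ ≠ 0 ∨ c₂ ≠ 0) :
    (shadowL (fun a => Ψ a - η • Ψ β) X c₁ c₂, (lmap c₁ c₂ (Ψ x₀ - η • Ψ β - η • Ψ γ)).val) ∈ Lst := by
  classical
  set φ : A →+ ZMod p := (lmap c₁ c₂).comp Ψ with hφ
  have hφs : Function.Surjective φ := (lmap_surjective_of_ne hc).comp hΨ
  have eφ : ∀ a, φ a = lmap c₁ c₂ (Ψ a) := fun a => rfl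
  set F : List ℕ := shadowL (fun a => Ψ a - η • Ψ β) X c₁ c₂ with hF
  -- the shadow counts are the `F`-terms of the line identity along `φ`
  have hFw : ∀ w : ZMod p, (X.filter fun a => φ a = w + η * φ β).card = vecFn F w := by
    intro w
    show _ = F.getD w.val 0
    rw [hF, getD_shadowL]
    refine congrArg Finset.card (Finset.filter_congr fun a _ => ?_)
    rw [eφ, eφ, map_sub, lmap_smul]
    constructor
    · intro e; rw [e]; ring
    · intro e; rw [← e]; ring
  have hs : φ x₀ - η * φ β - η * φ γ = lmap c₁ c₂ (Ψ x₀ - η • Ψ β - η • Ψ γ) := by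
    rw [eφ, eφ, eφ, map_sub, map_sub, lmap_smul, lmap_smul]
  have hid : ∀ τ : ZMod p, (∑ v : ZMod p, (vecFn F (τ - v) + vecFn F (v - τ) + vecFn F (τ + v)) *
      (Y.filter fun a => φ a = v + η * φ γ).card) +
      (if lmap c₁ c₂ (Ψ x₀ - η • Ψ β - η • Ψ γ) = τ then 1 else 0) = K := by
    intro τ
    have h0 := line_identity_of_shifted_form φ η hη hinj hPQ hPR hQR hcover τ
    rw [card_fibre_eq_of_card φ hφs hA, hs] at h0
    simp only [hFw] at h0
    exact h0
  have hmem : F ∈ compsLB [] p d := by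
    refine mem_compsLB [] p d F (by rw [hF, length_shadowL]) (by rw [hF, sum_shadowL, hXd]) fun k _ => ?_
    rw [List.getD_nil]; exact Nat.zero_le _
  exact hcomp F hmem _ _ hid

end Direction

end ZpZpDomino

end Summit.MatrixMultiplication.OmegaCensus
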